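import Summits.FinalStateConjecture.FinalStateConjecture.Theorems.EIHFluxBalanceInertialRecessionStubPseudotensorBoundMatrix
import Summits.FinalStateConjecture.FinalStateConjecture.Theorems.EIHFluxBalanceInertialRecessionStubPseudotensorBoundCalculus

/-!
# Stub `stub_pseudotensorBound` (line `sublinear-is-free-clean-window-charges`), part 4:
# the Ricci and Einstein components in the `2`-jet of the components

Helper file for `stmt-FinalStateConjecture-10166` (crux `InertialRecession`). For components `g`
that are `C²` at `x`, symmetric near `x`, with `det (g_{μν}(x)) ≠ 0`, we expand the Ricci
components `ricci g x i j = Ric_x(∂_i, ∂_j)` of `CoordCurvature.lean`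
(`Ric(Y,Z) = tr (X ↦ R(X,Y)Z)`, `R = DΓ − DΓ + ΓΓ − ΓΓ`) through the Christoffel symbols
`Γ^m_{pq} = ½ g^{ml}(∂_p g_{ql} + ∂_q g_{lp} − ∂_l g_{pq})` and their derivatives
`∂_c Γ^m_{pq} = ½[−(g⁻¹∂_c g g⁻¹)^{ml}(…) + g^{ml}(∂_c∂_p g_{ql} + …)]` into an explicit polynomial in
`g^{ij}`, `∂g`, `∂∂g` at `x`: `R_{ij} = RLIN_{ij}(∂∂g) + RQUAD_{ij}(∂g,∂g)` (`ricci_eq_twoJet`, LL (92.1),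
(92.7)), and hence the contravariant Einstein tensor `G^{μν} = GLIN + GQUAD` (`einsteinUpper_eq_twoJet`).
The displayed expressions are machine-generated from the template of part 3 and machine-checked
against exact rational 2-jet arithmetic (job `ptb-symbolcheck`).
-/

noncomputable section

set_option linter.dupNamespace false
set_option linter.unusedSimpArgs false
set_option maxSynthPendingDepth 3
set_option maxRecDepth 16384

open Filter Set
open scoped Topology Matrix

namespace Summit.FinalStateConjecture.FinalStateConjecture.Theorems.SublinearIsFree.PseudotensorBound

open Literature.Geometry.Lorentzian Literature.Geometry.Lorentzian.LandauLifshitz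
  Literature.Analysis.Calculus

variable {g : E4 → E4 →L[ℝ] E4 →L[ℝ] ℝ} {x y : E4}

/-- The coordinate vectors `∂_μ` (local shorthand). -/
local notation "𝐞" => E4.basisVector

/-- **Christoffel symbols near `x`**: on a neighbourhood of `x`,
`Γ_y(∂_p,∂_q)^m = ½ Σ_l g^{ml}(∂_p g_{ql} + ∂_q g_{lp} − ∂_l g_{pq})` (part 2, `chrAt_coord`).
[cite: LandauLifshitz1975, §86 (86.3)] -/
theorem chrAt_coord_eventuallyEq (hg : ContDiffAt ℝ 2 g x)
    (hs : ∀ᶠ z in 𝓝 x, ∀ v w : E4, g z v w = g z w v) (hdet : metricDet g x ≠ 0) (p q m : Fin 4) :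
    (fun y ↦ (MetricCoord.chrAt g y (𝐞 p) (𝐞 q)) m) =ᶠ[𝓝 x] fun y ↦
      2⁻¹ * (∑ l, upper g y m l * (fderiv ℝ g y (𝐞 p) (𝐞 q) (𝐞 l) + fderiv ℝ g y (𝐞 q) (𝐞 l) (𝐞 p) -
        fderiv ℝ g y (𝐞 l) (𝐞 p) (𝐞 q))) := by
  filter_upwards [eventually_metricDet_ne_zero hg hdet, hs.eventually_nhds] with y hdy hsy
  exact chrAt_coord (isInvertible_of_metricDet_ne_zero hdy) (hsy.self_of_nhds) p q m

/-- **Derivatives of the Christoffel symbols at `x` in the `2`-jet**: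
`∂_c Γ^m_{pq}(x) = ½ Σ_l [−(g⁻¹ ∂_c g g⁻¹)^{ml} (∂_p g_{ql} + ∂_q g_{lp} − ∂_l g_{pq})
  + g^{ml} (∂_c∂_p g_{ql} + ∂_c∂_q g_{lp} − ∂_c∂_l g_{pq})]`. [cite: LandauLifshitz1975, §92 (92.1)] -/
theorem fderiv_chrAt_coord_eq (hg : ContDiffAt ℝ 2 g x)
    (hs : ∀ᶠ z in 𝓝 x, ∀ v w : E4, g z v w = g z w v) (hdet : metricDet g x ≠ 0) (c p q m : Fin 4) :
    (fderiv ℝ (MetricCoord.chrAt g) x (𝐞 c) (𝐞 p) (𝐞 q)) m =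
      2⁻¹ * (∑ l, (-((∑ v1, ∑ v2, upper g x m v1 * upper g x v2 l * fderiv ℝ g x (𝐞 c) (𝐞 v1) (𝐞
        v2)) * (fderiv ℝ g x (𝐞 p) (𝐞 q) (𝐞 l) + fderiv ℝ g x (𝐞 q) (𝐞 l) (𝐞 p) - fderiv ℝ g x (𝐞 l)
        (𝐞 p) (𝐞 q))) + upper g x m l * (fderiv ℝ (fderiv ℝ g) x (𝐞 c) (𝐞 p) (𝐞 q) (𝐞 l) + fderiv ℝ
        (fderiv ℝ g) x (𝐞 c) (𝐞 q) (𝐞 l) (𝐞 p) - fderiv ℝ (fderiv ℝ g) x (𝐞 c) (𝐞 l) (𝐞 p) (𝐞 q)))) := by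
  have hgx := differentiableAt_of_contDiffAt hg
  have hi := isInvertible_of_metricDet_ne_zero hdet
  have hu : ∀ i j, HasFDerivAt (fun z ↦ upper g z i j) (fderiv ℝ (fun z ↦ upper g z i j) x) x :=
    fun i j ↦ (differentiableAt_upper hgx hdet i j).hasFDerivAt
  have hd : ∀ a i j, HasFDerivAt (fun y ↦ fderiv ℝ g y (𝐞 a) (𝐞 i) (𝐞 j))
      (fderiv ℝ (fun y ↦ fderiv ℝ g y (𝐞 a) (𝐞 i) (𝐞 j)) x) x :=
    fun a i j ↦ (differentiableAt_fderiv_apply₃ hg (𝐞 a) (𝐞 i) (𝐞 j)).hasFDerivAt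
  rw [← fderiv_chrAt_coord hg hi (𝐞 p) (𝐞 q) (𝐞 c) m,
    (chrAt_coord_eventuallyEq hg hs hdet p q m).fderiv_eq]
  have h : HasFDerivAt (fun y ↦
      2⁻¹ * (∑ l, upper g y m l * (fderiv ℝ g y (𝐞 p) (𝐞 q) (𝐞 l) + fderiv ℝ g y (𝐞 q) (𝐞 l) (𝐞 p) -
        fderiv ℝ g y (𝐞 l) (𝐞 p) (𝐞 q)))) _ x :=
    (((HasFDerivAt.fun_sum fun l _ ↦ (((hu m l)).fun_mul (((((hd p q l)).fun_add (hd q l p))).fun_sub (hd l p q))))).const_mul (2⁻¹ : ℝ))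
  rw [h.fderiv]
  simp only [_root_.add_apply, _root_.sub_apply, _root_.neg_apply, _root_.smul_apply,
    _root_.sum_apply, smul_eq_mul, fderiv_upper hgx hdet, fderiv_fderiv_apply₃ hg]
  simp only [Fin.sum_univ_four]
  ring

/-- `Γ(∂_c, Γ(∂_p,∂_q))^k = Σ_m Γ(∂_p,∂_q)^m Γ(∂_c,∂_m)^k` (linearity of `Γ(∂_c, ·)`). [folklore] -/
theorem chrAt_chrAt_coord (c p q k : Fin 4) :
    (MetricCoord.chrAt g x (𝐞 c) (MetricCoord.chrAt g x (𝐞 p) (𝐞 q))) k =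
      ∑ m, (MetricCoord.chrAt g x (𝐞 p) (𝐞 q)) m * (MetricCoord.chrAt g x (𝐞 c) (𝐞 m)) k := by
  set Y : E4 := MetricCoord.chrAt g x (𝐞 p) (𝐞 q) with hY
  have h : Y = ∑ m, Y m • 𝐞 m := by
    have h := (EuclideanSpace.basisFun (Fin 4) ℝ).sum_repr' Y
    conv_lhs => rw [← h]
    simp [EuclideanSpace.inner_single_left]
  conv_lhs => rw [h]
  simp only [map_sum, map_smul, WithLp.ofLp_sum, WithLp.ofLp_smul, Finset.sum_apply, Pi.smul_apply,
    smul_eq_mul]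

/-- **The Ricci components in the `2`-jet of the components.** For `g` of class `C²` at `x`,
symmetric near `x`, with `det (g_{μν}(x)) ≠ 0`:
`R_{ij}(x) = Σ_c [∂_c Γ^c_{ij} − ∂_i Γ^c_{cj} + Σ_m Γ^m_{ij} Γ^c_{cm} − Σ_m Γ^m_{cj} Γ^c_{im}]`
(`ricAt(Y,Z) = tr (X ↦ R(X,Y)Z)`, LL (92.7)), with `Γ`, `∂Γ` expanded in `g^{ij}`, `∂g`, `∂∂g`
(the raw shape; it is split into its `∂∂g`-linear and `∂g`-quadratic parts in part 5).
[cite: LandauLifshitz1975, §92 (92.7)] -/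
theorem ricci_eq_twoJet (hg : ContDiffAt ℝ 2 g x)
    (hs : ∀ᶠ z in 𝓝 x, ∀ v w : E4, g z v w = g z w v) (hdet : metricDet g x ≠ 0) (i j : Fin 4) :
    ricci g x i j =
      ∑ c, (2⁻¹ * (∑ l, (-((∑ v1, ∑ v2, upper g x c v1 * upper g x v2 l * fderiv ℝ g x (𝐞 c) (𝐞 v1)
        (𝐞 v2)) * (fderiv ℝ g x (𝐞 i) (𝐞 j) (𝐞 l) + fderiv ℝ g x (𝐞 j) (𝐞 l) (𝐞 i) - fderiv ℝ g x (𝐞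
        l) (𝐞 i) (𝐞 j))) + upper g x c l * (fderiv ℝ (fderiv ℝ g) x (𝐞 c) (𝐞 i) (𝐞 j) (𝐞 l) + fderiv
        ℝ (fderiv ℝ g) x (𝐞 c) (𝐞 j) (𝐞 l) (𝐞 i) - fderiv ℝ (fderiv ℝ g) x (𝐞 c) (𝐞 l) (𝐞 i) (𝐞
        j)))) - 2⁻¹ * (∑ l, (-((∑ v1, ∑ v2, upper g x c v1 * upper g x v2 l * fderiv ℝ g x (𝐞 i) (𝐞
        v1) (𝐞 v2)) * (fderiv ℝ g x (𝐞 c) (𝐞 j) (𝐞 l) + fderiv ℝ g x (𝐞 j) (𝐞 l) (𝐞 c) - fderiv ℝ g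
        x (𝐞 l) (𝐞 c) (𝐞 j))) + upper g x c l * (fderiv ℝ (fderiv ℝ g) x (𝐞 i) (𝐞 c) (𝐞 j) (𝐞 l) +
        fderiv ℝ (fderiv ℝ g) x (𝐞 i) (𝐞 j) (𝐞 l) (𝐞 c) - fderiv ℝ (fderiv ℝ g) x (𝐞 i) (𝐞 l) (𝐞 c)
        (𝐞 j)))) + (∑ m, 2⁻¹ * (∑ l, upper g x m l * (fderiv ℝ g x (𝐞 i) (𝐞 j) (𝐞 l) + fderiv ℝ g x
        (𝐞 j) (𝐞 l) (𝐞 i) - fderiv ℝ g x (𝐞 l) (𝐞 i) (𝐞 j))) * (2⁻¹ * (∑ l, upper g x c l * (fderiv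
        ℝ g x (𝐞 c) (𝐞 m) (𝐞 l) + fderiv ℝ g x (𝐞 m) (𝐞 l) (𝐞 c) - fderiv ℝ g x (𝐞 l) (𝐞 c) (𝐞
        m))))) - (∑ m, 2⁻¹ * (∑ l, upper g x m l * (fderiv ℝ g x (𝐞 c) (𝐞 j) (𝐞 l) + fderiv ℝ g x (𝐞
        j) (𝐞 l) (𝐞 c) - fderiv ℝ g x (𝐞 l) (𝐞 c) (𝐞 j))) * (2⁻¹ * (∑ l, upper g x c l * (fderiv ℝ g
        x (𝐞 i) (𝐞 m) (𝐞 l) + fderiv ℝ g x (𝐞 m) (𝐞 l) (𝐞 i) - fderiv ℝ g x (𝐞 l) (𝐞 i) (𝐞 m)))))) := by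
  have hi := isInvertible_of_metricDet_ne_zero hdet
  have hsx : ∀ v w : E4, g x v w = g x w v := hs.self_of_nhds
  have hb : ∀ c, ((EuclideanSpace.basisFun (Fin 4) ℝ).toBasis c : E4) = 𝐞 c := fun c ↦ by
    simp [EuclideanSpace.basisFun_apply]
  have hcoord : ∀ (c) (v : E4), (EuclideanSpace.basisFun (Fin 4) ℝ).toBasis.coord c v = v c :=
    fun c v ↦ by simp [Module.Basis.coord_apply]
  unfold ricci
  rw [MetricCoord.ricAt_eq_sum_coord (EuclideanSpace.basisFun (Fin 4) ℝ).toBasis]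
  simp only [hb, hcoord, MetricCoord.riemAt_apply, PiLp.add_apply, PiLp.sub_apply,
    chrAt_chrAt_coord, fderiv_chrAt_coord_eq hg hs hdet, chrAt_coord hi hsx]

/-- **The contravariant Einstein tensor in the `2`-jet of the components** (raw shape):
`G^{μν} = g^{μa}g^{νb}R_{ab} − ½ g^{μν} g^{ab}R_{ab}` (part 1) with `R_{ab}` expanded by
`ricci_eq_twoJet`. [cite: LandauLifshitz1975, §96 (96.7)] -/
theorem einsteinUpper_eq_twoJet (hg : ContDiffAt ℝ 2 g x)
    (hs : ∀ᶠ z in 𝓝 x, ∀ v w : E4, g z v w = g z w v) (hdet : metricDet g x ≠ 0) (μ ν : Fin 4) :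
    einsteinUpper g x μ ν =
      (∑ a1, ∑ a2, upper g x μ a1 * upper g x ν a2 * (∑ c, (2⁻¹ * (∑ l, (-((∑ v1, ∑ v2, upper g x c
        v1 * upper g x v2 l * fderiv ℝ g x (𝐞 c) (𝐞 v1) (𝐞 v2)) * (fderiv ℝ g x (𝐞 a1) (𝐞 a2) (𝐞 l)
        + fderiv ℝ g x (𝐞 a2) (𝐞 l) (𝐞 a1) - fderiv ℝ g x (𝐞 l) (𝐞 a1) (𝐞 a2))) + upper g x c l *
        (fderiv ℝ (fderiv ℝ g) x (𝐞 c) (𝐞 a1) (𝐞 a2) (𝐞 l) + fderiv ℝ (fderiv ℝ g) x (𝐞 c) (𝐞 a2) (𝐞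
        l) (𝐞 a1) - fderiv ℝ (fderiv ℝ g) x (𝐞 c) (𝐞 l) (𝐞 a1) (𝐞 a2)))) - 2⁻¹ * (∑ l, (-((∑ v1, ∑
        v2, upper g x c v1 * upper g x v2 l * fderiv ℝ g x (𝐞 a1) (𝐞 v1) (𝐞 v2)) * (fderiv ℝ g x (𝐞
        c) (𝐞 a2) (𝐞 l) + fderiv ℝ g x (𝐞 a2) (𝐞 l) (𝐞 c) - fderiv ℝ g x (𝐞 l) (𝐞 c) (𝐞 a2))) +
        upper g x c l * (fderiv ℝ (fderiv ℝ g) x (𝐞 a1) (𝐞 c) (𝐞 a2) (𝐞 l) + fderiv ℝ (fderiv ℝ g) x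
        (𝐞 a1) (𝐞 a2) (𝐞 l) (𝐞 c) - fderiv ℝ (fderiv ℝ g) x (𝐞 a1) (𝐞 l) (𝐞 c) (𝐞 a2)))) + (∑ m, 2⁻¹
        * (∑ l, upper g x m l * (fderiv ℝ g x (𝐞 a1) (𝐞 a2) (𝐞 l) + fderiv ℝ g x (𝐞 a2) (𝐞 l) (𝐞 a1)
        - fderiv ℝ g x (𝐞 l) (𝐞 a1) (𝐞 a2))) * (2⁻¹ * (∑ l, upper g x c l * (fderiv ℝ g x (𝐞 c) (𝐞
        m) (𝐞 l) + fderiv ℝ g x (𝐞 m) (𝐞 l) (𝐞 c) - fderiv ℝ g x (𝐞 l) (𝐞 c) (𝐞 m))))) - (∑ m, 2⁻¹ *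
        (∑ l, upper g x m l * (fderiv ℝ g x (𝐞 c) (𝐞 a2) (𝐞 l) + fderiv ℝ g x (𝐞 a2) (𝐞 l) (𝐞 c) -
        fderiv ℝ g x (𝐞 l) (𝐞 c) (𝐞 a2))) * (2⁻¹ * (∑ l, upper g x c l * (fderiv ℝ g x (𝐞 a1) (𝐞 m)
        (𝐞 l) + fderiv ℝ g x (𝐞 m) (𝐞 l) (𝐞 a1) - fderiv ℝ g x (𝐞 l) (𝐞 a1) (𝐞 m)))))))) - 2⁻¹ *
        upper g x μ ν * (∑ a1, ∑ a2, upper g x a1 a2 * (∑ c, (2⁻¹ * (∑ l, (-((∑ v1, ∑ v2, upper g x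
        c v1 * upper g x v2 l * fderiv ℝ g x (𝐞 c) (𝐞 v1) (𝐞 v2)) * (fderiv ℝ g x (𝐞 a1) (𝐞 a2) (𝐞
        l) + fderiv ℝ g x (𝐞 a2) (𝐞 l) (𝐞 a1) - fderiv ℝ g x (𝐞 l) (𝐞 a1) (𝐞 a2))) + upper g x c l *
        (fderiv ℝ (fderiv ℝ g) x (𝐞 c) (𝐞 a1) (𝐞 a2) (𝐞 l) + fderiv ℝ (fderiv ℝ g) x (𝐞 c) (𝐞 a2) (𝐞
        l) (𝐞 a1) - fderiv ℝ (fderiv ℝ g) x (𝐞 c) (𝐞 l) (𝐞 a1) (𝐞 a2)))) - 2⁻¹ * (∑ l, (-((∑ v1, ∑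
        v2, upper g x c v1 * upper g x v2 l * fderiv ℝ g x (𝐞 a1) (𝐞 v1) (𝐞 v2)) * (fderiv ℝ g x (𝐞
        c) (𝐞 a2) (𝐞 l) + fderiv ℝ g x (𝐞 a2) (𝐞 l) (𝐞 c) - fderiv ℝ g x (𝐞 l) (𝐞 c) (𝐞 a2))) +
        upper g x c l * (fderiv ℝ (fderiv ℝ g) x (𝐞 a1) (𝐞 c) (𝐞 a2) (𝐞 l) + fderiv ℝ (fderiv ℝ g) x
        (𝐞 a1) (𝐞 a2) (𝐞 l) (𝐞 c) - fderiv ℝ (fderiv ℝ g) x (𝐞 a1) (𝐞 l) (𝐞 c) (𝐞 a2)))) + (∑ m, 2⁻¹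
        * (∑ l, upper g x m l * (fderiv ℝ g x (𝐞 a1) (𝐞 a2) (𝐞 l) + fderiv ℝ g x (𝐞 a2) (𝐞 l) (𝐞 a1)
        - fderiv ℝ g x (𝐞 l) (𝐞 a1) (𝐞 a2))) * (2⁻¹ * (∑ l, upper g x c l * (fderiv ℝ g x (𝐞 c) (𝐞
        m) (𝐞 l) + fderiv ℝ g x (𝐞 m) (𝐞 l) (𝐞 c) - fderiv ℝ g x (𝐞 l) (𝐞 c) (𝐞 m))))) - (∑ m, 2⁻¹ *
        (∑ l, upper g x m l * (fderiv ℝ g x (𝐞 c) (𝐞 a2) (𝐞 l) + fderiv ℝ g x (𝐞 a2) (𝐞 l) (𝐞 c) -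
        fderiv ℝ g x (𝐞 l) (𝐞 c) (𝐞 a2))) * (2⁻¹ * (∑ l, upper g x c l * (fderiv ℝ g x (𝐞 a1) (𝐞 m)
        (𝐞 l) + fderiv ℝ g x (𝐞 m) (𝐞 l) (𝐞 a1) - fderiv ℝ g x (𝐞 l) (𝐞 a1) (𝐞 m)))))))) := by
  have hsx : ∀ v w : E4, g x v w = g x w v := hs.self_of_nhds
  rw [einsteinUpper_eq hsx hdet]
  unfold scalar
  simp only [ricci_eq_twoJet hg hs hdet]

/-! ### Registered sub-goal form -/

/-- Registered sub-goal form (part 4) of `ricci_eq_twoJet`. [cite: LandauLifshitz1975, §92 (92.7)] -/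
theorem pseudotensorBound_ricci_twoJet : open Literature.Geometry.Lorentzian in ∀ {g : E4 → E4 →L[ℝ] E4 →L[ℝ] ℝ} {x : E4}, ContDiffAt ℝ 2 g x → (∀ᶠ z in nhds x, ∀ v w : E4, g z v w = g z w v) → LandauLifshitz.metricDet g x ≠ 0 → ∀ i j : Fin 4, LandauLifshitz.ricci g x i j = ∑ c, (2⁻¹ * (∑ l, (-((∑ v1, ∑ v2, LandauLifshitz.upper g x c v1 * LandauLifshitz.upper g x v2 l * fderiv ℝ g x (E4.basisVector c) (E4.basisVector v1) (E4.basisVector v2)) * (fderiv ℝ g x (E4.basisVector i) (E4.basisVector j) (E4.basisVector l) + fderiv ℝ g x (E4.basisVector j) (E4.basisVector l) (E4.basisVector i) - fderiv ℝ g x (E4.basisVector l) (E4.basisVector i) (E4.basisVector j))) + LandauLifshitz.upper g x c l * (fderiv ℝ (fderiv ℝ g) x (E4.basisVector c) (E4.basisVector i) (E4.basisVector j) (E4.basisVector l) + fderiv ℝ (fderiv ℝ g) x (E4.basisVector c) (E4.basisVector j) (E4.basisVector l) (E4.basisVector i) - fderiv ℝ (fderiv ℝ g) x (E4.basisVector c)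 (E4.basisVector l) (E4.basisVector i) (E4.basisVector j)))) - 2⁻¹ * (∑ l, (-((∑ v1, ∑ v2, LandauLifshitz.upper g x c v1 * LandauLifshitz.upper g x v2 l * fderiv ℝ g x (E4.basisVector i) (E4.basisVector v1) (E4.basisVector v2)) * (fderiv ℝ g x (E4.basisVector c) (E4.basisVector j) (E4.basisVector l) + fderiv ℝ g x (E4.basisVector j) (E4.basisVector l) (E4.basisVector c) - fderiv ℝ g x (E4.basisVector l) (E4.basisVector c) (E4.basisVector j))) + LandauLifshitz.upper g x c l * (fderiv ℝ (fderiv ℝ g) x (E4.basisVector i) (E4.basisVector c) (E4.basisVector j) (E4.basisVector l) + fderiv ℝ (fderiv ℝ g) x (E4.basisVector i) (E4.basisVector j) (E4.basisVector l) (E4.basisVector c) - fderiv ℝ (fderiv ℝ g) x (E4.basisVector i) (E4.basisVector l) (E4.basisVector c) (E4.basisVector j)))) + (∑ m, 2⁻¹ * (∑ l, LandauLifshitz.upper g x m l * (fderiv ℝ g x (E4.basisVector i) (E4.basisVector j) (E4.basisVector l) + fderiv ℝ g x (E4.basisVector j) (E4.basisVector l) (E4.basisVector i) - fderiv ℝ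 g x (E4.basisVector l) (E4.basisVector i) (E4.basisVector j))) * (2⁻¹ * (∑ l, LandauLifshitz.upper g x c l * (fderiv ℝ g x (E4.basisVector c) (E4.basisVector m) (E4.basisVector l) + fderiv ℝ g x (E4.basisVector m) (E4.basisVector l) (E4.basisVector c) - fderiv ℝ g x (E4.basisVector l) (E4.basisVector c) (E4.basisVector m))))) - (∑ m, 2⁻¹ * (∑ l, LandauLifshitz.upper g x m l * (fderiv ℝ g x (E4.basisVector c) (E4.basisVector j) (E4.basisVector l) + fderiv ℝ g x (E4.basisVector j) (E4.basisVector l) (E4.basisVector c) - fderiv ℝ g x (E4.basisVector l) (E4.basisVector c) (E4.basisVector j))) * (2⁻¹ * (∑ l, LandauLifshitz.upper g x c l * (fderiv ℝ g x (E4.basisVector i) (E4.basisVector m) (E4.basisVector l) + fderiv ℝ g x (E4.basisVector m) (E4.basisVector l) (E4.basisVector i) - fderiv ℝ g x (E4.basisVector l) (E4.basisVector i) (E4.basisVector m)))))) :=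
  fun hg hs hdet i j ↦ ricci_eq_twoJet hg hs hdet i j

end Summit.FinalStateConjecture.FinalStateConjecture.Theorems.SublinearIsFree.PseudotensorBound

end
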